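import Summits.RiemannHypothesis.RiemannHypothesis.Theorems.PfPersistenceM2ThresholdOpen
import Summits.RiemannHypothesis.RiemannHypothesis.Theorems.RuelleBandExactFirstBandStubEvenSymTranslate
import Summits.RiemannHypothesis.RiemannHypothesis.Theorems.RuelleBandExactFirstBandStubEvenTransfer
import Summits.RiemannHypothesis.RiemannHypothesis.Theorems.RuelleBandExactFirstBandStubEvenExpSum
import Literature.NumberTheory.LFunctions.ZetaZerosReflection
import HarnessLib

/-!
# Pf-persistence index route (M2): the translation defect of Weil's functional and the lone-quadruple comparison

pub-rhpf cell (M2 seat, generation 9).  HONEST FRAMING: long-odds MECHANISM SEARCH; no RH claims.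
Every result in this file is RH-free and kernel-checked; none asserts or refutes RH.  Labels: PROVED.

Notation. `k` a Weil test (`IsWeilTest`), `Q(k) = weilQuadratic k`, `k̂ = weilMellin k`,
`P_k(ρ) = k̂(ρ) conj k̂(1-ρ̄)` (`WeilConverse.pairCoeff`; `= k̂(ρ)²` for even real `k`),
`m(ρ) = riemannZetaZeroOrder ρ`, `g_T = 𝔰⟪k, T⟫ = (k(·-T) + k(·+T))/2`, and the ZERO-SIDE WEIGHT
`F(ρ,T) = 𝔉⟪ρ, T⟫ = (e^{(ρ-½)2T} + e^{(½-ρ)2T} + 2)/4 = cosh²((ρ-½)T)`, so that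
`P_{g_T}(ρ) = P_k(ρ) F(ρ,T)` (`pairCoeff_symTranslate`, RuelleBand stub file, reused by name).

PROVED here:
* (T1) `zeroForm_symShift_sub`, `re_weilQuadratic_symShift_sub` — the TRANSLATION-DEFECT identity
  `Re Q(g_T) - Re Q(k) = Σ'_ρ Re (m(ρ) P_k(ρ) (F(ρ,T) - 1))` (Weil's explicit formula on both sides).
* (T2) `re_defect_nonpos_of_re_eq_half` — a zero ON the critical line contributes
  `m |k̂(ρ)|² (cos²(γT) - 1) ≤ 0`: translation can only LOWER the energy through on-line zeros.
* `re_defect_conj`, `re_defect_one_sub` — the defect term is invariant under `ρ ↦ ρ̄`, `ρ ↦ 1-ρ`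
  (even real `k`; order symmetries `riemannZetaZeroOrder_conj_holds` / `_one_sub_holds`).
* (T3) `re_weilQuadratic_symShift_le_of_lone` — in the LONE-QUADRUPLE WORLD (every off-line zero lies
  in `{e, ē, 1-e, 1-ē}`, i.e. `K = #𝒬 = 1`): `Re Q(g_T) ≤ Re Q(k) + 4 m(e) Re (P_k(e)(F(e,T) - 1))`
  for every even real Weil test `k` and every `T` (tsum ≤ the finite sum over the quadruple, by T2).
* (T4) `re_mul_coshSq_sub_one_le` — PHASE LEMMA: if `z e^{2iγT} = -|z|` then
  `Re (z (F(e,T) - 1)) ≤ -(|z|/2)(sinh(2δT) - 1)`, `δ = Re e - ½`, `γ = Im e`; and `exists_tuned` —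
  such tuned `T` exist in every window `[T₀, T₀ + π/γ]`.
The effective threshold / rigidity / `Ω₋` consequences are in `PfPersistenceM2EffectiveThreshold`.

HONEST GRADE (problem-relative): VARIANT of the Landau–Littlewood `Ω` mechanism (a zero off the line
forces oscillations of explicit exponential size; Littlewood's localisation to `[x, Cx]` when the
abscissa `Θ` is attained) [cite: MontgomeryVaughan2007,
Thm. 15.3, Thm. 15.8, notes p. 368], transported to Weil's quadratic functional through symmetric
translates [cite: Bombieri2000Weil, §5].  New in the tree: the defect identity with the explicit
weight `cosh²` and the exact lone-quadruple comparison (the tree's off-line negativity results —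
`evenNegativityOffLine`, `frequently_weilGroundEnergy_lt_of_offline_zero`, the generation-6
accumulation theorem — are `∃ᶠ` / asymptotic).  mechanism/rigidity campaign; no RH claims.
-/

noncomputable section

set_option linter.dupNamespace false

open Complex Filter Set MeasureTheory
open scoped Real Topology ComplexConjugate BigOperators

namespace Summit.RiemannHypothesis.RiemannHypothesis.Theorems.PfPersistenceM2NegIndex

open Literature.NumberTheory.LFunctions
open Literature.NumberTheory.LFunctions.WeilConverse
open Literature.NumberTheory.LFunctions.ZetaZeros
open Summit.RiemannHypothesis.RiemannHypothesis.Theorems.RuelleBandExactFirstBand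

/-! ## The symmetric translate and its zero-side weight (local notations, no new definitions) -/

/-- `𝔰⟪k, T⟫ = g_T`, the symmetric translate `t ↦ (k(t - T) + k(t + T)) / 2`. -/
local notation "𝔰⟪" k ", " T "⟫" => fun t : ℝ => (k (t - T) + k (t + T)) / 2

/-- `𝔉⟪ρ, T⟫ = F(ρ,T) = (e^{(ρ-½)2T} + e^{(½-ρ)2T} + 2)/4 = cosh²((ρ-½)T)`, the zero-side weight of
`g_T`: `P_{g_T}(ρ) = P_k(ρ) F(ρ,T)` (`pairCoeff_symTranslate`). -/
local notation "𝔉⟪" ρ ", " T "⟫" =>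
  (cexp ((ρ - 1 / 2) * ((2 * T : ℝ) : ℂ)) + cexp ((1 / 2 - ρ) * ((2 * T : ℝ) : ℂ)) + 2) / 4

/-! ## (T1) The translation-defect identity -/

/-- The defect family `ρ ↦ m(ρ) P_k(ρ) (F(ρ,T) - 1)` is summable. -/
theorem summable_defect {k : ℝ → ℂ} (hk : IsWeilTest k) (T : ℝ) :
    Summable fun ρ : riemannZetaNontrivialZeros ↦
      (riemannZetaZeroOrder (ρ : ℂ) : ℂ) * pairCoeff k ρ * (𝔉⟪ρ, T⟫ - 1) := by
  refine ((summable_pairCoeff (isWeilTest_symTranslate hk T)).sub (summable_pairCoeff hk)).congr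
    fun ρ ↦ ?_
  show _ - _ = _
  rw [pairCoeff_symTranslate hk T ρ]
  ring

/-- **(T1)** `Z(g_T) - Z(k) = Σ'_ρ m(ρ) P_k(ρ) (F(ρ,T) - 1)`. -/
theorem zeroForm_symShift_sub {k : ℝ → ℂ} (hk : IsWeilTest k) (T : ℝ) :
    zeroForm (𝔰⟪k, T⟫) - zeroForm k =
      ∑' ρ : riemannZetaNontrivialZeros,
        (riemannZetaZeroOrder (ρ : ℂ) : ℂ) * pairCoeff k ρ * (𝔉⟪ρ, T⟫ - 1) := by
  rw [zeroForm, zeroForm,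
    ← (summable_pairCoeff (isWeilTest_symTranslate hk T)).tsum_sub (summable_pairCoeff hk)]
  refine tsum_congr fun ρ ↦ ?_
  rw [pairCoeff_symTranslate hk T ρ]
  ring

/-- **(T1, real form)** `Re Q(g_T) - Re Q(k) = Σ'_ρ Re (m(ρ) P_k(ρ) (F(ρ,T) - 1))`. -/
theorem re_weilQuadratic_symShift_sub {k : ℝ → ℂ} (hk : IsWeilTest k) (T : ℝ) :
    (weilQuadratic (𝔰⟪k, T⟫)).re - (weilQuadratic k).re =
      ∑' ρ : riemannZetaNontrivialZeros,
        ((riemannZetaZeroOrder (ρ : ℂ) : ℂ) * pairCoeff k ρ * (𝔉⟪ρ, T⟫ - 1)).re := by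
  -- `Z = Q` on both sides: Weil's explicit formula (both are the limit of the symmetric partial
  -- zero sums of `k ⋆ k̃`, `hasWeilZeroSide_zeroForm` / `explicit_formula_holds`)
  have hQ1 : zeroForm (𝔰⟪k, T⟫) = weilQuadratic (𝔰⟪k, T⟫) :=
    tendsto_nhds_unique (hasWeilZeroSide_zeroForm (isWeilTest_symTranslate hk T))
      (explicit_formula_holds
        ((isWeilTest_symTranslate hk T).weilConv (isWeilTest_symTranslate hk T).weilReflect))
  have hQ0 : zeroForm k = weilQuadratic k :=
    tendsto_nhds_unique (hasWeilZeroSide_zeroForm hk) (explicit_formula_holds (hk.weilConv hk.weilReflect))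
  rw [← hQ1, ← hQ0, ← Complex.sub_re, zeroForm_symShift_sub hk, Complex.re_tsum (summable_defect hk T)]

/-- **(T1, B-series form)** `Re Q(g_T) = (Re B_k(2T) + Re Q(k)) / 2`, where
`B_k(y) = Σ'_ρ m(ρ) P_k(ρ) e^{(ρ-½)y}` (`WeilConverse.expSum`; `zeroForm_symTranslate`). -/
theorem re_weilQuadratic_symShift_eq {k : ℝ → ℂ} (hk : IsWeilTest k) (T : ℝ) :
    (weilQuadratic (𝔰⟪k, T⟫)).re = ((expSum k (2 * T)).re + (weilQuadratic k).re) / 2 := by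
  have h := re_weilQuadratic_symShift_sub hk T
  have hZ : zeroForm (𝔰⟪k, T⟫) - zeroForm k =
      ((((expSum k (2 * T)).re : ℝ) : ℂ) + zeroForm k) / 2 - zeroForm k := by
    rw [show 𝔰⟪k, T⟫ = fun t : ℝ ↦ (k (t - T) + k (t + T)) / 2 from rfl, zeroForm_symTranslate hk T]
  rw [zeroForm_symShift_sub hk] at hZ
  have hre := congrArg Complex.re hZ
  rw [Complex.re_tsum (summable_defect hk T)] at hre
  simp only [Complex.sub_re, Complex.div_ofNat_re, Complex.add_re, Complex.ofReal_re] at hre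
  -- `(zeroForm k).re` appears in `hre`; eliminate it with `h`
  have hQ0 : zeroForm k = weilQuadratic k :=
    tendsto_nhds_unique (hasWeilZeroSide_zeroForm hk) (explicit_formula_holds (hk.weilConv hk.weilReflect))
  rw [hQ0] at hre
  linarith

/-! ## (T2) Zeros on the critical line only lower the energy under translation -/

/-- On the critical line the weight is `cos²(γT) = (cos(2γT) + 1)/2`, a real number in `[0, 1]`. -/
theorem coshSq_of_re_eq_half {ρ : ℂ} (hρ : ρ.re = 1 / 2) (T : ℝ) :
    𝔉⟪ρ, T⟫ = (((Real.cos (ρ.im * (2 * T)) + 1) / 2 : ℝ) : ℂ) := by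
  have hw : (ρ - 1 / 2) * ((2 * T : ℝ) : ℂ) = ((ρ.im * (2 * T) : ℝ) : ℂ) * I := by
    apply Complex.ext <;> simp [hρ]
  have hw' : (1 / 2 - ρ) * ((2 * T : ℝ) : ℂ) = ((-(ρ.im * (2 * T)) : ℝ) : ℂ) * I := by
    rw [show (1 / 2 - ρ) * ((2 * T : ℝ) : ℂ) = -((ρ - 1 / 2) * ((2 * T : ℝ) : ℂ)) by ring, hw]
    push_cast
    ring
  rw [hw, hw', Complex.exp_mul_I, Complex.exp_mul_I, ← Complex.ofReal_cos, ← Complex.ofReal_sin,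
    ← Complex.ofReal_cos, ← Complex.ofReal_sin, Real.cos_neg, Real.sin_neg]
  push_cast
  ring

/-- **(T2)** a zero on the critical line contributes `m |k̂(ρ)|² (cos²(γT) - 1) ≤ 0` to the defect. -/
theorem re_defect_nonpos_of_re_eq_half (k : ℝ → ℂ) {ρ : ℂ} (hρmem : ρ ∈ riemannZetaNontrivialZeros)
    (hρ : ρ.re = 1 / 2) (T : ℝ) :
    ((riemannZetaZeroOrder ρ : ℂ) * pairCoeff k ρ * (𝔉⟪ρ, T⟫ - 1)).re ≤ 0 := by
  have h1 : 1 - conj ρ = ρ := Complex.ext (by simp [hρ]; norm_num) (by simp)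
  have hP : pairCoeff k ρ = (Complex.normSq (weilMellin k ρ) : ℂ) := by
    rw [pairCoeff, h1, Complex.mul_conj]
  have hm : (0 : ℝ) ≤ riemannZetaZeroOrder ρ := by
    exact_mod_cast riemannZetaZeroOrder_nonneg (riemannZetaNontrivialZeros.ne_one hρmem)
  have hc : (Real.cos (ρ.im * (2 * T)) + 1) / 2 - 1 ≤ 0 := by
    linarith [Real.cos_le_one (ρ.im * (2 * T))]
  rw [hP, coshSq_of_re_eq_half hρ,
    show (riemannZetaZeroOrder ρ : ℂ) * (Complex.normSq (weilMellin k ρ) : ℂ) *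
        ((((Real.cos (ρ.im * (2 * T)) + 1) / 2 : ℝ) : ℂ) - 1) =
      (((riemannZetaZeroOrder ρ : ℝ) * Complex.normSq (weilMellin k ρ) *
        ((Real.cos (ρ.im * (2 * T)) + 1) / 2 - 1) : ℝ) : ℂ) by push_cast; ring,
    Complex.ofReal_re]
  nlinarith [mul_nonneg hm (Complex.normSq_nonneg (weilMellin k ρ)), hc]

/-! ## Symmetries of the weight and of the pairing under `ρ ↦ conj ρ`, `ρ ↦ 1 - ρ` -/

/-- `F(ρ̄,T) = conj F(ρ,T)`. -/
theorem coshSq_conj (ρ : ℂ) (T : ℝ) : 𝔉⟪conj ρ, T⟫ = conj (𝔉⟪ρ, T⟫) := by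
  simp only [map_div₀, map_add, map_ofNat, ← Complex.exp_conj, map_mul, map_sub, map_one,
    Complex.conj_ofReal]

/-- `F(1-ρ,T) = F(ρ,T)`. -/
theorem coshSq_one_sub (ρ : ℂ) (T : ℝ) : 𝔉⟪1 - ρ, T⟫ = 𝔉⟪ρ, T⟫ := by
  have h1 : (1 - ρ - 1 / 2) * ((2 * T : ℝ) : ℂ) = (1 / 2 - ρ) * ((2 * T : ℝ) : ℂ) := by ring
  have h2 : (1 / 2 - (1 - ρ)) * ((2 * T : ℝ) : ℂ) = (ρ - 1 / 2) * ((2 * T : ℝ) : ℂ) := by ring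
  rw [h1, h2]
  ring

/-- For an even real test, `P_k(conj ρ) = conj (P_k(ρ))`. -/
theorem pairCoeff_conj_of_even_real {k : ℝ → ℂ} (hev : ∀ t : ℝ, k (-t) = k t)
    (hre : ∀ t : ℝ, (k t).im = 0) (ρ : ℂ) : pairCoeff k (conj ρ) = conj (pairCoeff k ρ) := by
  rw [stub_evenTransfer_pairCoeff hev hre, stub_evenTransfer_pairCoeff hev hre, weilMellin_conj hev hre,
    map_mul]

/-- The defect term is invariant under `ρ ↦ conj ρ` (even real test). -/
theorem re_defect_conj {k : ℝ → ℂ} (hev : ∀ t : ℝ, k (-t) = k t) (hre : ∀ t : ℝ, (k t).im = 0)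
    (ρ : ℂ) (T : ℝ) :
    ((riemannZetaZeroOrder (conj ρ) : ℂ) * pairCoeff k (conj ρ) * (𝔉⟪conj ρ, T⟫ - 1)).re =
      ((riemannZetaZeroOrder ρ : ℂ) * pairCoeff k ρ * (𝔉⟪ρ, T⟫ - 1)).re := by
  rw [riemannZetaZeroOrder_conj_holds ρ, pairCoeff_conj_of_even_real hev hre, coshSq_conj,
    show (riemannZetaZeroOrder ρ : ℂ) * conj (pairCoeff k ρ) * (conj (𝔉⟪ρ, T⟫) - 1) =
      conj ((riemannZetaZeroOrder ρ : ℂ) * pairCoeff k ρ * (𝔉⟪ρ, T⟫ - 1)) by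
        simp only [map_mul, map_sub, map_one, map_intCast],
    Complex.conj_re]

/-- The defect term is invariant under `ρ ↦ 1 - ρ` (even test, `0 < Re ρ < 1`). -/
theorem re_defect_one_sub {k : ℝ → ℂ} (hev : ∀ t : ℝ, k (-t) = k t) {ρ : ℂ} (h0 : 0 < ρ.re)
    (h1 : ρ.re < 1) (T : ℝ) :
    ((riemannZetaZeroOrder (1 - ρ) : ℂ) * pairCoeff k (1 - ρ) * (𝔉⟪1 - ρ, T⟫ - 1)).re =
      ((riemannZetaZeroOrder ρ : ℂ) * pairCoeff k ρ * (𝔉⟪ρ, T⟫ - 1)).re := by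
  rw [riemannZetaZeroOrder_one_sub_holds h0 h1, pairCoeff_one_sub_of_even hev, coshSq_one_sub]


/-- For an even real test the pairing at `e` is `k̂(e)²`, of norm `|k̂(e)|²`. -/
theorem norm_pairCoeff_of_even_real {k : ℝ → ℂ} (hev : ∀ t : ℝ, k (-t) = k t)
    (hre : ∀ t : ℝ, (k t).im = 0) (e : ℂ) : ‖pairCoeff k e‖ = ‖weilMellin k e‖ ^ 2 := by
  rw [stub_evenTransfer_pairCoeff hev hre, norm_mul, sq]

/-! ## (T3) The lone-quadruple world: the defect IS the quadruple's contribution -/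

/-- **(T3)** If every off-line zero of `ζ` lies in the quadruple `{e, ē, 1-e, 1-ē}` of one zero `e`
with `Re e > 1/2` (the `K = 1` world), then for every even real Weil test `k` and every `T`:
`Re Q(g_T) ≤ Re Q(k) + 4 m(e) Re (P_k(e) (F(e,T) - 1))` — the on-line zeros only lower the energy
(T2), and the four quadruple terms coincide by the order / pairing / weight symmetries. -/
theorem re_weilQuadratic_symShift_le_of_lone {k : ℝ → ℂ} (hk : IsWeilTest k)
    (hev : ∀ t : ℝ, k (-t) = k t) (hre : ∀ t : ℝ, (k t).im = 0) {e : ℂ}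
    (he : e ∈ riemannZetaNontrivialZeros) (hδ : 1 / 2 < e.re)
    (hlone : ∀ ρ ∈ riemannZetaNontrivialZeros,
      ρ.re ≠ 1 / 2 → ρ = e ∨ ρ = conj e ∨ ρ = 1 - e ∨ ρ = 1 - conj e) (T : ℝ) :
    (weilQuadratic (𝔰⟪k, T⟫)).re ≤ (weilQuadratic k).re +
      4 * (riemannZetaZeroOrder e * (pairCoeff k e * (𝔉⟪e, T⟫ - 1)).re) := by
  set F : ℂ → ℝ := fun ρ ↦
    ((riemannZetaZeroOrder ρ : ℂ) * pairCoeff k ρ * (𝔉⟪ρ, T⟫ - 1)).re with hF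
  have hdiff : (weilQuadratic (𝔰⟪k, T⟫)).re - (weilQuadratic k).re =
      ∑' ρ : riemannZetaNontrivialZeros, F ρ := re_weilQuadratic_symShift_sub hk T
  have hsF : Summable fun ρ : riemannZetaNontrivialZeros ↦ F ρ := by
    simpa [hF] using Complex.reCLM.summable (summable_defect hk T)
  have h0 : 0 < e.re := by linarith
  have h1 : e.re < 1 := riemannZetaNontrivialZeros.re_lt_one he
  have him : e.im ≠ 0 := riemannZetaNontrivialZeros.im_ne_zero he
  have hce : conj e ∈ riemannZetaNontrivialZeros := riemannZetaNontrivialZeros.conj_mem he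
  have h1e : 1 - e ∈ riemannZetaNontrivialZeros := by
    simpa using riemannZetaNontrivialZeros.one_sub_conj_mem hce
  have h1ce : 1 - conj e ∈ riemannZetaNontrivialZeros :=
    riemannZetaNontrivialZeros.one_sub_conj_mem he
  -- the defect term at each member of the quadruple equals `m(e) · Re (P_k(e) (F(e,T) - 1))`
  have hFe : F e = riemannZetaZeroOrder e * (pairCoeff k e * (𝔉⟪e, T⟫ - 1)).re := by
    simp only [hF]
    rw [mul_assoc, ← Complex.ofReal_intCast, Complex.re_ofReal_mul]
  have hFce : F (conj e) = F e := by
    simp only [hF]; exact re_defect_conj hev hre e T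
  have hF1e : F (1 - e) = F e := by
    simp only [hF]; exact re_defect_one_sub hev h0 h1 T
  have hF1ce : F (1 - conj e) = F e := by
    rw [← hFce]; simp only [hF]
    exact re_defect_one_sub hev (by simpa using h0) (by simpa using h1) T
  -- the quadruple as a finset of the index type; off it, every zero is on the line
  set S : Finset riemannZetaNontrivialZeros :=
    {⟨e, he⟩, ⟨conj e, hce⟩, ⟨1 - e, h1e⟩, ⟨1 - conj e, h1ce⟩} with hS
  have hmemS : ∀ ρ : riemannZetaNontrivialZeros, (ρ : ℂ).re ≠ 1 / 2 → ρ ∈ S := by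
    intro ρ hρ
    rcases hlone ρ ρ.2 hρ with h | h | h | h
    · rw [show ρ = ⟨e, he⟩ from Subtype.ext h, hS]; simp
    · rw [show ρ = ⟨conj e, hce⟩ from Subtype.ext h, hS]; simp
    · rw [show ρ = ⟨1 - e, h1e⟩ from Subtype.ext h, hS]; simp
    · rw [show ρ = ⟨1 - conj e, h1ce⟩ from Subtype.ext h, hS]; simp
  set g : riemannZetaNontrivialZeros → ℝ := fun ρ ↦ if ρ ∈ S then F ρ else 0 with hg
  have hg0 : ∀ ρ ∉ S, g ρ = 0 := fun ρ hρ ↦ if_neg hρ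
  have hle : ∀ ρ : riemannZetaNontrivialZeros, F ρ ≤ g ρ := by
    intro ρ
    by_cases hρ : ρ ∈ S
    · simp only [hg, if_pos hρ, le_refl]
    · have hline : (ρ : ℂ).re = 1 / 2 := by
        by_contra hne
        exact hρ (hmemS ρ hne)
      simp only [hg, if_neg hρ, hF]
      exact re_defect_nonpos_of_re_eq_half k ρ.2 hline T
  have htsum : ∑' ρ : riemannZetaNontrivialZeros, F ρ ≤ ∑ ρ ∈ S, F ρ :=
    calc ∑' ρ : riemannZetaNontrivialZeros, F ρ ≤ ∑' ρ, g ρ :=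
          hsF.tsum_le_tsum hle (summable_of_ne_finset_zero hg0)
      _ = ∑ ρ ∈ S, g ρ := tsum_eq_sum hg0
      _ = ∑ ρ ∈ S, F ρ := Finset.sum_congr rfl fun ρ hρ ↦ if_pos hρ
  -- the four members are distinct (`Im e ≠ 0`, `Re e ≠ 1/2`)
  have hne12 : e ≠ conj e := fun h ↦ him (by
    have := congrArg Complex.im h; simp at this; linarith)
  have hne13 : e ≠ 1 - e := fun h ↦ by
    have := congrArg Complex.re h; simp at this; linarith
  have hne14 : e ≠ 1 - conj e := fun h ↦ by
    have := congrArg Complex.re h; simp at this; linarith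
  have hne23 : conj e ≠ 1 - e := fun h ↦ by
    have := congrArg Complex.re h; simp at this; linarith
  have hne24 : conj e ≠ 1 - conj e := fun h ↦ by
    have := congrArg Complex.re h; simp at this; linarith
  have hne34 : 1 - e ≠ 1 - conj e := fun h ↦ him (by
    have := congrArg Complex.im h; simp at this; linarith)
  have hsumS : ∑ ρ ∈ S, F ρ = 4 * F e := by
    rw [hS, Finset.sum_insert, Finset.sum_insert,
      Finset.sum_pair (fun h ↦ hne34 (congrArg Subtype.val h))]
    · show F e + (F (conj e) + (F (1 - e) + F (1 - conj e))) = 4 * F e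
      rw [hFce, hF1e, hF1ce]; ring
    · simp only [Finset.mem_insert, Finset.mem_singleton, Subtype.mk.injEq, not_or]
      exact ⟨hne23, hne24⟩
    · simp only [Finset.mem_insert, Finset.mem_singleton, Subtype.mk.injEq, not_or]
      exact ⟨hne12, hne13, hne14⟩
  linarith [hdiff, htsum, hsumS, hFe]

/-! ## (T4) The phase lemma and the existence of tuned translations -/

/-- **(T4) Phase lemma.** If the phase of `z` is tuned against the height `γ = Im e`,
`z · e^{2iγT} = -|z|`, then `Re (z (F(e,T) - 1)) ≤ -(|z|/2)(sinh(2δT) - 1)`, `δ = Re e - 1/2`. -/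
theorem re_mul_coshSq_sub_one_le {z e : ℂ} {T : ℝ}
    (htune : z * cexp (((e.im * (2 * T) : ℝ) : ℂ) * I) = -(‖z‖ : ℂ)) :
    (z * (𝔉⟪e, T⟫ - 1)).re ≤ -(‖z‖ / 2) * (Real.sinh (2 * (e.re - 1 / 2) * T) - 1) := by
  set u : ℝ := 2 * (e.re - 1 / 2) * T with hu
  set θ : ℝ := e.im * (2 * T) with hθ
  have hexp1 : cexp ((e - 1 / 2) * ((2 * T : ℝ) : ℂ)) = (Real.exp u : ℂ) * cexp ((θ : ℂ) * I) := by
    rw [Complex.ofReal_exp, ← Complex.exp_add]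
    congr 1
    apply Complex.ext <;> (simp [hu, hθ]; try ring)
  have hexp2 : cexp ((1 / 2 - e) * ((2 * T : ℝ) : ℂ)) =
      (Real.exp (-u) : ℂ) * conj (cexp ((θ : ℂ) * I)) := by
    rw [← Complex.exp_conj, Complex.ofReal_exp, ← Complex.exp_add]
    congr 1
    apply Complex.ext <;> (simp [hu, hθ, Complex.conj_ofReal]; try ring)
  have hB : (z * conj (cexp ((θ : ℂ) * I))).re ≤ ‖z‖ := by
    refine (Complex.re_le_norm _).trans_eq ?_
    rw [norm_mul, Complex.norm_conj, Complex.norm_exp_ofReal_mul_I, mul_one]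
  have hz : -‖z‖ ≤ z.re := (abs_le.1 (Complex.abs_re_le_norm z)).1
  have hmain : (z * (𝔉⟪e, T⟫ - 1)).re =
      (Real.exp u * (z * cexp ((θ : ℂ) * I)).re +
        Real.exp (-u) * (z * conj (cexp ((θ : ℂ) * I))).re + 2 * z.re) / 4 - z.re := by
    rw [hexp1, hexp2,
      show z * (((Real.exp u : ℂ) * cexp ((θ : ℂ) * I) +
          (Real.exp (-u) : ℂ) * conj (cexp ((θ : ℂ) * I)) + 2) / 4 - 1) =
        ((Real.exp u : ℂ) * (z * cexp ((θ : ℂ) * I)) +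
          (Real.exp (-u) : ℂ) * (z * conj (cexp ((θ : ℂ) * I))) + ((2 : ℝ) : ℂ) * z) / 4 - z by
        push_cast; ring]
    simp only [Complex.sub_re, Complex.div_ofNat_re, Complex.add_re, Complex.re_ofReal_mul]
  rw [hmain, htune, show (-(‖z‖ : ℂ)).re = -‖z‖ by simp, Real.sinh_eq u]
  nlinarith [mul_le_mul_of_nonneg_left hB (Real.exp_pos (-u)).le, hz, Real.exp_pos u,
    norm_nonneg z]

/-- **Tuned translations exist in every window of length `π/γ`.** For `z : ℂ` and `γ > 0` there
is `T ∈ [T₀, T₀ + π/γ]` with `z · e^{2iγT} = -|z|` (take `2γT = π - arg z (mod 2π)`). -/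
theorem exists_tuned (z : ℂ) {γ : ℝ} (hγ : 0 < γ) (T₀ : ℝ) :
    ∃ T ∈ Icc T₀ (T₀ + π / γ), z * cexp (((γ * (2 * T) : ℝ) : ℂ) * I) = -(‖z‖ : ℂ) := by
  have h2π : (0 : ℝ) < 2 * π := by positivity
  set x : ℝ := 2 * γ * T₀ - π + arg z with hx
  obtain ⟨n, hn1, hn2⟩ : ∃ n : ℤ, x / (2 * π) ≤ n ∧ (n : ℝ) < x / (2 * π) + 1 :=
    ⟨⌈x / (2 * π)⌉, Int.le_ceil _, Int.ceil_lt_add_one _⟩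
  have hn1' : x ≤ n * (2 * π) := (div_le_iff₀ h2π).1 hn1
  have hn2' : ((n : ℝ) - 1) * (2 * π) < x := (lt_div_iff₀ h2π).1 (by linarith)
  refine ⟨(π - arg z + 2 * π * n) / (2 * γ), ⟨?_, ?_⟩, ?_⟩
  · rw [le_div_iff₀ (by positivity)]
    linarith
  · rw [div_le_iff₀ (by positivity),
      show (T₀ + π / γ) * (2 * γ) = 2 * γ * T₀ + 2 * π by field_simp]
    linarith
  · have hT : γ * (2 * ((π - arg z + 2 * π * n) / (2 * γ))) = π - arg z + 2 * π * n := by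
      field_simp
    rw [hT]
    calc z * cexp (((π - arg z + 2 * π * n : ℝ) : ℂ) * I)
        = (‖z‖ : ℂ) * (cexp ((arg z : ℂ) * I) * cexp (((π - arg z + 2 * π * n : ℝ) : ℂ) * I)) := by
          rw [← mul_assoc, Complex.norm_mul_exp_arg_mul_I]
      _ = (‖z‖ : ℂ) * (cexp (π * I) * cexp (n * (2 * π * I))) := by
          rw [← Complex.exp_add, ← Complex.exp_add]
          congr 2
          push_cast
          ring
      _ = -(‖z‖ : ℂ) := by
          rw [Complex.exp_pi_mul_I, Complex.exp_int_mul_two_pi_mul_I]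
          ring

end Summit.RiemannHypothesis.RiemannHypothesis.Theorems.PfPersistenceM2NegIndex
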